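import Literature.NumberTheory.Weil1965.ThetaIntegralOrbitFunctionalCutoff
import Literature.NumberTheory.Weil1965.ThetaIntegralOrbitFunctionalSupport
import Literature.NumberTheory.Weil1965.ThetaIntegralOrbitFunctionalComplex
import Literature.NumberTheory.Weil1965.AdelicFibreMeasuresComparison
import Literature.NumberTheory.Weil1965.AdelicSiegelFunctionalComplex
import Summits.HodgeConjecture.HodgeConjecture.Theorems.H413E2SWIdentityCloseFibre
import Literature.NumberTheory.Li1992.RallisDoubledPairCarriers
import HarnessLib

/-!
# H413 · E-2 · SW2 (iii) — THE I-CLOSE OUTER ASSEMBLY: `I□ Ψ = κ₀ · E(Ψ)` from fibrewise proportionality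

Cell `hodgecm-mathlib`, crux H413 (`stmt-HodgeConjecture-24833`), child line
`Cruxes/H413/Lines/F0_E2SiegelWeilWeilRange.lean` ED. 8, stub `stub_SW2iii_siegelWeil : StubSW2iii`, IDENTITY HALF
(`doubledThetaIntegral … ν Ψ = κ · eis … Ψ`, `κ := (ν univ).toReal`); pen sheet `F0/P4/F0P2a-p08/SW2-ICLOSE-ASSEMBLY.v0` §2
step (5) (row F0P4-plan (g4) 2026-08-31T03:29Z → B-p03 (g23)).  CLOSER-MODULO-LETTERS in the SW4 recipe: every input that
is not yet a tree theorem is a NAMED HYPOTHESIS in its producer's head shape; the file elaborates today and shrinks as the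
producers land.  Literature-only imports (a `Theorems` file may not import a `Lines` file): the conclusion is stated for an
ARBITRARY functional `Eis` satisfying the (E-DEC) head shape, and the child's `eis (actRat …) (ratDoubledW …) (stabDiagRat …) (ev0 …)`
is substituted at the fold.  HC_CM is proved only modulo the 7 printed citations until rung 0 closes; nothing here is about
Hodge classes.

THE MATHEMATICS ([Weil1965] n° 51–52, proof of Thm. 5: «`E″ = E′ − E` est nulle»).  Both sides of the Siegel–Weil identity are
`rank-0 term + a POSITIVE tempered measure on X□(𝔸) carried by the rational fibres of the hermitian norm hNorm`:
* Θ-side (★ B-p10, I-STRUCT-I): `I□(Ψ) = ν([U(J_V)])·Ψ♮(0) + Λ_θ(Ψ♮)` (★ `doubledThetaIntegral_eq_measure_mul_apply_zero_add_thetaOrbitFunctional`),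
  `Λ_θ` positive (★ `thetaOrbitFunctionalReal_nonneg`), continuous along compactly supported cut-offs
  (★ `tendsto_thetaOrbitFunctionalReal_mul`), carried by `hNorm⁻¹(F)` (★ `thetaOrbitFunctionalReal_support`);
* E-side ((E-DEC), B-p02 row 03:33:50Z over ★ `eis_unfold` + ★ R4): `E(Ψ) = Ψ♮(0) + Σ_ξ F*_{Ψ♮}(ξ) = Ψ♮(0) + E_X(Re Ψ♮) + i E_X(Im Ψ♮)`
  (★ `tsum_adelicSiegelCoeff_eq_re_add_im`), `E_X = adelicSiegelFunctional` positive (★), carried by `hNorm⁻¹(F)`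
  (★ `adelicSiegelFunctional_eq_zero_of_tsupport_subset`), continuous along cut-offs (§2, from the temperedness `htemp` of the (E-DEC) letter).
* the closing step (★ `AdelicFibreMeasuresComparison` ED. 2 `linearMap_eq_smul_of_forall_integral_fibreMeasure_eq`): two such functionals
  whose FIBRE MEASURES ARE PROPORTIONAL WHEN TESTED ON COMPACTLY SUPPORTED `𝒮_ℝ`-FUNCTIONS (`hfib`, the output of the split-place step
  (1)–(4): (BRIDGE-v), (J-v), (CV-v), (BOUND-b)) are proportional: `Λ_θ,ℝ = κ₀ • E_X` — no measure equality, no (RECT), no density theorem.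
* §3 assembly: `I□(Ψ) = κ₀Ψ♮(0) + κ₀(E_X(Re Ψ♮) + iE_X(Im Ψ♮)) = κ₀ · E(Ψ)` (★ `thetaOrbitFunctional_eq_re_add_im`, B-p10).

References: A. Weil, *Sur la formule de Siegel dans la théorie des groupes classiques*, Acta Math. 113 (1965), Chap. I n° 2
Lemmes 2–5 pp. 7–10, Chap. IV n° 41 (35) p. 59, Chap. V n° 50 pp. 72–74, Chap. VI n° 51–52 Théorème 5 pp. 75–77 [Weil1965].
-/

set_option autoImplicit false
-- the cell's `Summit.HodgeConjecture.HodgeConjecture.…` namespace repeats the summit name by design (D-0017 layout)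
set_option linter.dupNamespace false

noncomputable section

open MeasureTheory NumberField Filter Topology Set IsDedekindDomain
open scoped NNReal Classical Matrix ENNReal
open Literature.NumberTheory.Automorphic Literature.NumberTheory.Weil1964 Literature.NumberTheory.Weil1965
open Literature.NumberTheory.Weil1965.UnitaryDoubling
open Literature.NumberTheory.GelbartRogawski1991 Literature.NumberTheory.GelbartRogawski1991.UnitaryDualPair
open Literature.RepresentationTheory.HeisenbergGroup
open Literature.NumberTheory.GaloisRepresentations.IsNonarchimedeanLocalField
open Literature.NumberTheory.Li1992

namespace Summit.HodgeConjecture.HodgeConjecture.Cruxes.H413.E2SWIdentityClose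

/-! ## §1 The dual pair -/

section DualPair

variable (F E : Type) [Field F] [NumberField F] [Field E] [NumberField E] [Algebra F E] [Algebra.IsQuadraticExtension F E]
  (c : E ≃ₐ[F] E) {δ : E} (hcδ : c δ = -δ) (hδ : δ ≠ 0) {d : F} (hd : δ * δ = algebraMap F E d)
  (N : ℕ) {n : ℕ} (e : Fin N × Fin 1 ≃ Fin n)
  (TV : Matrix (Fin N) (Fin N) F) (hV : TV.IsSymm) (hVd : IsUnit TV.det)
  (TW : Matrix (Fin 1) (Fin 1) F) (hW : TW.IsSymm) (hWd : IsUnit TW.det)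
  [LocallyCompactSpace (UnitaryGroup.adelic F E c N (TV.map (algebraMap F E)))]
  [CompactSpace (UnitaryGroup.adelic F E c N (TV.map (algebraMap F E)) ⧸ (UnitaryGroup.toAdelic F E c N (TV.map (algebraMap F E))).range)]
  [MeasurableSpace (UnitaryGroup.adelic F E c N (TV.map (algebraMap F E)) ⧸ (UnitaryGroup.toAdelic F E c N (TV.map (algebraMap F E))).range)]
  [BorelSpace (UnitaryGroup.adelic F E c N (TV.map (algebraMap F E)) ⧸ (UnitaryGroup.toAdelic F E c N (TV.map (algebraMap F E))).range)]
  (ν : Measure (UnitaryGroup.adelic F E c N (TV.map (algebraMap F E)) ⧸ (UnitaryGroup.toAdelic F E c N (TV.map (algebraMap F E))).range))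
  [IsFiniteMeasure ν]

variable [MeasurableSpace (adeleQuotient F)] [BorelSpace (adeleQuotient F)]
  [MeasurableSpace (AdeleRing (𝓞 F) F)] [BorelSpace (AdeleRing (𝓞 F) F)]
  (νX : Measure (Fin (n + n) → AdeleRing (𝓞 F) F)) [νX.IsAddHaarMeasure]
  (h : (Fin (n + n) → AdeleRing (𝓞 F) F) → AdeleRing (𝓞 F) F) (hh : Continuous h)

/-! ## §2 The E-side functional is continuous along cut-offs (from temperedness, by dominated convergence) -/

/-- **CUT-OFF CONTINUITY OF `E_X` FROM TEMPEREDNESS**: if `E_X` IS its Radon measure on `𝒮_ℝ` (`htemp`, the (E-DEC) letter's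
hypothesis VERBATIM — ★ `E2SWEisDecomposition`, discharged for totally real `F` by `htemp_C0`), then `E_X(Ψ c_k) → E_X(Ψ)` along every
`[0,1]`-valued Schwartz–Bruhat cut-off sequence `c_k → 1` (dominated convergence, dominator `|Ψ|`). [cite: Weil1965, Chap. I n° 2, Lemme 5, p. 9] -/
theorem tendsto_adelicSiegelFunctional_mul_of_tempered
    (hB : ∀ Φ ∈ piSchwartzBruhat F (Fin (n + n)), Summable fun ξ : F => ‖adelicSiegelCoeff F (Fin (n + n)) νX h Φ ξ‖)
    (htemp : ∀ Ψr : piSchwartzBruhatReal F (Fin (n + n)),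
      Integrable (Ψr : (Fin (n + n) → AdeleRing (𝓞 F) F) → ℝ) (adelicSiegelMeasure F (Fin (n + n)) νX h hh hB) ∧
        ∫ x, (Ψr : (Fin (n + n) → AdeleRing (𝓞 F) F) → ℝ) x ∂(adelicSiegelMeasure F (Fin (n + n)) νX h hh hB) = adelicSiegelFunctional F (Fin (n + n)) νX h hh hB Ψr)
    (cs : ℕ → (Fin (n + n) → AdeleRing (𝓞 F) F) → ℝ) (hcS : ∀ k, cs k ∈ piSchwartzBruhatReal F (Fin (n + n)))
    (hc01 : ∀ k x, cs k x ∈ Set.Icc (0 : ℝ) 1) (hlim : ∀ x, Tendsto (fun k => cs k x) atTop (𝓝 1))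
    (Θ : piSchwartzBruhatReal F (Fin (n + n))) :
    Tendsto (fun k => adelicSiegelFunctional F (Fin (n + n)) νX h hh hB ⟨(Θ : (Fin (n + n) → AdeleRing (𝓞 F) F) → ℝ) * cs k, mul_mem_piSchwartzBruhatReal Θ.2 (hcS k)⟩) atTop
      (𝓝 (adelicSiegelFunctional F (Fin (n + n)) νX h hh hB Θ)) := by
  haveI := secondCountableTopology_adeleRing (K := F)
  haveI : BorelSpace (Fin (n + n) → AdeleRing (𝓞 F) F) := Pi.borelSpace
  have hI := (htemp Θ).1
  have hk : (fun k => adelicSiegelFunctional F (Fin (n + n)) νX h hh hB ⟨(Θ : (Fin (n + n) → AdeleRing (𝓞 F) F) → ℝ) * cs k, mul_mem_piSchwartzBruhatReal Θ.2 (hcS k)⟩) =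
      fun k => ∫ x, (Θ : (Fin (n + n) → AdeleRing (𝓞 F) F) → ℝ) x * cs k x ∂(adelicSiegelMeasure F (Fin (n + n)) νX h hh hB) :=
    funext fun k => ((htemp ⟨(Θ : (Fin (n + n) → AdeleRing (𝓞 F) F) → ℝ) * cs k, mul_mem_piSchwartzBruhatReal Θ.2 (hcS k)⟩).2).symm
  rw [hk, ← (htemp Θ).2]
  refine tendsto_integral_of_dominated_convergence (fun x => ‖(Θ : (Fin (n + n) → AdeleRing (𝓞 F) F) → ℝ) x‖)
    (fun k => ((continuous_of_mem_piSchwartzBruhatReal Θ.2).mul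
      (continuous_of_mem_piSchwartzBruhatReal (hcS k))).aestronglyMeasurable) hI.norm
    (fun k => ae_of_all _ fun x => ?_) (ae_of_all _ fun x => ?_)
  · rw [norm_mul]
    refine mul_le_of_le_one_right (norm_nonneg _) ?_
    rw [Real.norm_eq_abs, abs_le]
    exact ⟨by linarith [(hc01 k x).1], (hc01 k x).2⟩
  · have h1 := (hlim x).const_mul ((Θ : (Fin (n + n) → AdeleRing (𝓞 F) F) → ℝ) x)
    rwa [mul_one] at h1

/-! ## §3 THE OUTER ASSEMBLY -/

/-- **(A) PROPORTIONALITY OF THE TWO FUNCTIONALS: `Λ_θ,ℝ = κ₀ • E_X` on `𝒮_ℝ(X□(𝔸))`**, `κ₀ := (ν univ).toReal`, for a continuous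
`h = hNorm` pointwise (`hhN`: the E-side letters write the hermitian norm as the closed `F`-form `sdForm F (ratMatrix F C₀)`; their identification
is (BRIDGE-v)'s lemma, B-p04 FILE 2), from: Weil's condition (B) `hB`, temperedness `htemp` (both VERBATIM the (E-DEC) letter's
hypotheses, ★ `E2SWEisDecomposition`), and the split-place output `hfib` — fibre proportionality TESTED ON NONNEGATIVE compactly
supported `Θ ∈ 𝒮_ℝ` (★ (T2b) `integral_eq_smul_integral_of_slices` per sliced `Θ`).  Proof: ★ (T2b) sign reduction, then the
integral-tested closing step ★ `linearMap_eq_smul_of_forall_integral_fibreMeasure_eq` fed with ★ positivity, ★ supports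
(`thetaOrbitFunctionalReal_support`, `adelicSiegelFunctional_eq_zero_of_tsupport_subset`), ★ theta-side cut-off continuity and §2.
[cite: Weil1965, Chap. VI n° 51–52, Théorème 5, pp. 75–77] -/
theorem thetaOrbitFunctionalReal_eq_smul_adelicSiegelFunctional
    (hhN : ∀ x, h x = hNorm F E c hcδ hδ N e TV hVd TW hWd x)
    (hB : ∀ Φ ∈ piSchwartzBruhat F (Fin (n + n)), Summable fun ξ : F => ‖adelicSiegelCoeff F (Fin (n + n)) νX h Φ ξ‖)
    (htemp : ∀ Ψr : piSchwartzBruhatReal F (Fin (n + n)),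
      Integrable (Ψr : (Fin (n + n) → AdeleRing (𝓞 F) F) → ℝ) (adelicSiegelMeasure F (Fin (n + n)) νX h hh hB) ∧
        ∫ x, (Ψr : (Fin (n + n) → AdeleRing (𝓞 F) F) → ℝ) x ∂(adelicSiegelMeasure F (Fin (n + n)) νX h hh hB) = adelicSiegelFunctional F (Fin (n + n)) νX h hh hB Ψr)
    (hfib : ∀ (b : F) (Θ : piSchwartzBruhatReal F (Fin (n + n))), 0 ≤ (Θ : (Fin (n + n) → AdeleRing (𝓞 F) F) → ℝ) →
      HasCompactSupport (Θ : (Fin (n + n) → AdeleRing (𝓞 F) F) → ℝ) →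
      ∫ x, (Θ : (Fin (n + n) → AdeleRing (𝓞 F) F) → ℝ) x ∂(fibreMeasure F (Fin (n + n)) (thetaOrbitFunctionalReal F E c hcδ hδ hd N e TV hV hVd TW hW hWd ν)
            (thetaOrbitFunctionalReal_nonneg F E c hcδ hδ hd N e TV hV hVd TW hW hWd ν) h b) =
        (ν Set.univ).toReal * ∫ x, (Θ : (Fin (n + n) → AdeleRing (𝓞 F) F) → ℝ) x ∂(adelicSiegelFibreMeasure F (Fin (n + n)) νX h hh hB b))
    :
    thetaOrbitFunctionalReal F E c hcδ hδ hd N e TV hV hVd TW hW hWd ν = (ν Set.univ).toReal • adelicSiegelFunctional F (Fin (n + n)) νX h hh hB := by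
  haveI := secondCountableTopology_adeleRing (K := F)
  haveI : BorelSpace (Fin (n + n) → AdeleRing (𝓞 F) F) := Pi.borelSpace
  -- one sequence of compactly supported tensor cut-offs (★ `exists_tensor_cutoff`)
  obtain ⟨U, β, -, -, -, -, -, hcS, hc01, hcs, hev⟩ := exists_tensor_cutoff F (Fin (n + n))
  have hlim : ∀ v : (Fin (n + n) → AdeleRing (𝓞 F) F),
      Tendsto (fun k => β k (piArch F (Fin (n + n)) v) * (U k).indicator 1 (piFinite F (Fin (n + n)) v)) atTop (𝓝 1) :=
    fun v => tendsto_const_nhds.congr' ((hev v).mono fun k hk => hk.symm)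
  -- the fibre measures are finite on compacta (restrictions of regular Radon measures): needed by the sign reduction
  have hreg₁ := regular_schwartzBruhatMeasure F (Fin (n + n)) (thetaOrbitFunctionalReal F E c hcδ hδ hd N e TV hV hVd TW hW hWd ν)
    (thetaOrbitFunctionalReal_nonneg F E c hcδ hδ hd N e TV hV hVd TW hW hWd ν)
  have hreg₂ := regular_schwartzBruhatMeasure F (Fin (n + n)) (adelicSiegelFunctional F (Fin (n + n)) νX h hh hB)
    (fun Ψ hΨ => (adelicSiegelFunctional_nonneg hh hB Ψ hΨ).1)
  have hfib' : ∀ (b : F) (Θ : piSchwartzBruhatReal F (Fin (n + n))), HasCompactSupport (Θ : (Fin (n + n) → AdeleRing (𝓞 F) F) → ℝ) →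
      ∫ x, (Θ : (Fin (n + n) → AdeleRing (𝓞 F) F) → ℝ) x ∂(fibreMeasure F (Fin (n + n)) (thetaOrbitFunctionalReal F E c hcδ hδ hd N e TV hV hVd TW hW hWd ν)
            (thetaOrbitFunctionalReal_nonneg F E c hcδ hδ hd N e TV hV hVd TW hW hWd ν) h b) =
        (ν Set.univ).toReal * ∫ x, (Θ : (Fin (n + n) → AdeleRing (𝓞 F) F) → ℝ) x ∂(fibreMeasure F (Fin (n + n)) (adelicSiegelFunctional F (Fin (n + n)) νX h hh hB)
            (fun Ψ hΨ => (adelicSiegelFunctional_nonneg hh hB Ψ hΨ).1) h b) := by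
    intro b Θ hΘ
    haveI : IsFiniteMeasureOnCompacts (fibreMeasure F (Fin (n + n)) (thetaOrbitFunctionalReal F E c hcδ hδ hd N e TV hV hVd TW hW hWd ν)
        (thetaOrbitFunctionalReal_nonneg F E c hcδ hδ hd N e TV hV hVd TW hW hWd ν) h b) := by
      unfold fibreMeasure; infer_instance
    haveI : IsFiniteMeasureOnCompacts (adelicSiegelFibreMeasure F (Fin (n + n)) νX h hh hB b) := by
      unfold adelicSiegelFibreMeasure fibreMeasure; infer_instance
    exact E2SWIdentityCloseTransport.integral_eq_mul_integral_of_forall_nonneg F (Fin (n + n)) _ _ _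
      (fun Θ' h0 hc => hfib b Θ' h0 hc) Θ hΘ
  refine linearMap_eq_smul_of_forall_integral_fibreMeasure_eq F (Fin (n + n)) _ _
    (thetaOrbitFunctionalReal_nonneg F E c hcδ hδ hd N e TV hV hVd TW hW hWd ν)
    (fun Ψ hΨ => (adelicSiegelFunctional_nonneg hh hB Ψ hΨ).1) h hh ?_
    (fun Θ L hL hL0 hΘL => adelicSiegelFunctional_eq_zero_of_tsupport_subset F (Fin (n + n)) νX h hh hB Θ L hL hL0 hΘL)
    (ν Set.univ).toReal hfib' _ hcS hcs
    (fun Θ => tendsto_thetaOrbitFunctionalReal_mul F E c hcδ hδ hd N e TV hV hVd TW hW hWd ν Θ _ hcS hc01 hlim)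
    (fun Θ => tendsto_adelicSiegelFunctional_mul_of_tempered F νX h hh hB htemp _ hcS hc01 hlim Θ)
  -- the theta-side support, read along `h = hNorm`
  intro Θ L hL hL0 hΘL
  exact thetaOrbitFunctionalReal_support F E c hcδ hδ hd N e TV hV hVd TW hW hWd ν Θ L hL
    (fun x hx => by rw [← hhN x]; exact hL0 x hx) hΘL

omit [MeasurableSpace (adeleQuotient F)] [BorelSpace (adeleQuotient F)] in
/-- **(B) THE ASSEMBLY FROM PROPORTIONALITY**: if `Λ_θ,ℝ = κ₀ • E_X` (output of (A)) and `Eis` has the (E-DEC) Fourier-side head shape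
`hE` (★ `E2SWEisFourierSide.eis_eq_geomFrame_zero_add_tsum_siegelCoeff`, B-p02), then `I□(Ψ) = κ₀ · Eis(Ψ)` —
★ `doubledThetaIntegral_eq_measure_mul_apply_zero_add_thetaOrbitFunctional` + ★ `tsum_adelicSiegelCoeff_eq_re_add_im` + ★ `thetaOrbitFunctional_eq_re_add_im`.
[cite: Weil1965, Chap. VI n° 52, Théorème 5, pp. 76–77] -/
theorem doubledThetaIntegral_eq_mul_of_proportional
    (hB : ∀ Φ ∈ piSchwartzBruhat F (Fin (n + n)), Summable fun ξ : F => ‖adelicSiegelCoeff F (Fin (n + n)) νX h Φ ξ‖)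
    (hprop : thetaOrbitFunctionalReal F E c hcδ hδ hd N e TV hV hVd TW hW hWd ν = (ν Set.univ).toReal • adelicSiegelFunctional F (Fin (n + n)) νX h hh hB)
    (Eis : piSchwartzBruhat F (Fin (n + n)) → ℂ)
    (hE : ∀ Ψ : piSchwartzBruhat F (Fin (n + n)), Eis Ψ =
      ((geomFrame F (adelicGram F e TV TW) (isUnit_det_adelicGram F e hVd hWd) Ψ : piSchwartzBruhat F (Fin (n + n))) : (Fin (n + n) → AdeleRing (𝓞 F) F) → ℂ) 0 + ∑' ξ : F, adelicSiegelCoeff F (Fin (n + n)) νX h ((geomFrame F (adelicGram F e TV TW) (isUnit_det_adelicGram F e hVd hWd) Ψ : piSchwartzBruhat F (Fin (n + n))) : (Fin (n + n) → AdeleRing (𝓞 F) F) → ℂ) ξ)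
    (Ψ : piSchwartzBruhat F (Fin (n + n))) :
    ∫ ξ, thetaDistLM F (Fin (n + n))
        (adelicMpCont.omega F (Fin (n + n)) (doubledGramFin F (adelicGram F e TV TW))
          (((doublingLift F (adelicGram F e TV TW) (isUnit_det_adelicGram F e hVd hWd)).comp
            (iotaV F E c hcδ hδ hd N e TV hV TW hW)) (Quotient.out ξ)⁻¹) Ψ) ∂ν =
      ((ν Set.univ).toReal : ℂ) * Eis Ψ := by
  rw [doubledThetaIntegral_eq_measure_mul_apply_zero_add_thetaOrbitFunctional F E c hcδ hδ hd N e TV hV hVd TW hW hWd ν Ψ, hE Ψ,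
    tsum_adelicSiegelCoeff_eq_re_add_im F (Fin (n + n)) hh hB
      (geomFrame F (adelicGram F e TV TW) (isUnit_det_adelicGram F e hVd hWd) Ψ).2,
    thetaOrbitFunctional_eq_re_add_im F E c hcδ hδ hd N e TV hV hVd TW hW hWd ν, hprop]
  simp only [LinearMap.smul_apply, smul_eq_mul, Complex.ofReal_mul]
  ring

/-- **I-CLOSE, OUTER ASSEMBLY (identity half of `StubSW2iii`, closer-modulo-letters) = (B) ∘ (A).**  For the rank-one unitary dual pair
`(U(J_V), U(J_W ⊕ −J_W))`, `κ₀ := (ν univ).toReal`, `νX` the self-dual Haar measure on `X□(𝔸) = 𝔸_F^{n+n}`, `h` the hermitian norm in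
the E-side letters' spelling (`hhN : ∀ x, h x = hNorm … x`).  HYPOTHESES BY NAME (producer → shape VERBATIM):
* `hhN` — the E-side closed `F`-form `sdForm F (ratMatrix F C₀)` IS `hNorm` [B-p04 FILE 2 `hNorm_eq_sub_dotProduct` ∕ (BRIDGE-v)];
* `hB` — Weil's condition (B) for `h` [★ `E2SWEisDecomposition` binder; discharged for totally real `F` by F0P4-p06's `hB_C0`];
* `htemp` — temperedness of `E_X` [★ `E2SWEisDecomposition` binder VERBATIM; discharged by F0P4-p06's `htemp_C0`];
* `hfib` — fibre proportionality along `h` with ratio `κ₀`, TESTED ON NONNEGATIVE compactly supported `Θ ∈ 𝒮_ℝ` [★ (T2b)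
  `integral_eq_smul_integral_of_slices` ∘ ★ (T2a), given the frame `e` (A-p01 `Theorems/H413E2SWSplitPlaceFrame`), the slices (★ B-p18
  TENS-v) and the dilate bounds (F0P4-p08 COEFF-b ∘ (**)′)];
* `hE` — the (E-DEC) Fourier-side head for the functional `Eis` [★ `E2SWEisFourierSide.eis_eq_geomFrame_zero_add_tsum_siegelCoeff`;
  at the fold `Eis := eis (actRat …) (ratDoubledW …) (stabDiagRat …) (ev0 …)`, its `hsum` = ★ SUM-iii].
CONCLUSION: `I□(Ψ) = κ₀ · Eis(Ψ)` with `I□` written as in ★ `doubledThetaIntegral_eq_measure_mul_apply_zero_add_thetaOrbitFunctional`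
(= the child's `doubledThetaIntegral`, `vDiagLift = doublingLift.comp iotaV` by `rfl`, B-p10 cert 8bc2a63a).
[cite: Weil1965, Chap. VI n° 52, Théorème 5, pp. 76–77] -/
theorem doubledThetaIntegral_eq_mul_of_fibre
    (hhN : ∀ x, h x = hNorm F E c hcδ hδ N e TV hVd TW hWd x)
    (hB : ∀ Φ ∈ piSchwartzBruhat F (Fin (n + n)), Summable fun ξ : F => ‖adelicSiegelCoeff F (Fin (n + n)) νX h Φ ξ‖)
    (htemp : ∀ Ψr : piSchwartzBruhatReal F (Fin (n + n)),
      Integrable (Ψr : (Fin (n + n) → AdeleRing (𝓞 F) F) → ℝ) (adelicSiegelMeasure F (Fin (n + n)) νX h hh hB) ∧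
        ∫ x, (Ψr : (Fin (n + n) → AdeleRing (𝓞 F) F) → ℝ) x ∂(adelicSiegelMeasure F (Fin (n + n)) νX h hh hB) = adelicSiegelFunctional F (Fin (n + n)) νX h hh hB Ψr)
    (hfib : ∀ (b : F) (Θ : piSchwartzBruhatReal F (Fin (n + n))), 0 ≤ (Θ : (Fin (n + n) → AdeleRing (𝓞 F) F) → ℝ) →
      HasCompactSupport (Θ : (Fin (n + n) → AdeleRing (𝓞 F) F) → ℝ) →
      ∫ x, (Θ : (Fin (n + n) → AdeleRing (𝓞 F) F) → ℝ) x ∂(fibreMeasure F (Fin (n + n)) (thetaOrbitFunctionalReal F E c hcδ hδ hd N e TV hV hVd TW hW hWd ν)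
            (thetaOrbitFunctionalReal_nonneg F E c hcδ hδ hd N e TV hV hVd TW hW hWd ν) h b) =
        (ν Set.univ).toReal * ∫ x, (Θ : (Fin (n + n) → AdeleRing (𝓞 F) F) → ℝ) x ∂(adelicSiegelFibreMeasure F (Fin (n + n)) νX h hh hB b))
    (Eis : piSchwartzBruhat F (Fin (n + n)) → ℂ)
    (hE : ∀ Ψ : piSchwartzBruhat F (Fin (n + n)), Eis Ψ =
      ((geomFrame F (adelicGram F e TV TW) (isUnit_det_adelicGram F e hVd hWd) Ψ : piSchwartzBruhat F (Fin (n + n))) : (Fin (n + n) → AdeleRing (𝓞 F) F) → ℂ) 0 + ∑' ξ : F, adelicSiegelCoeff F (Fin (n + n)) νX h ((geomFrame F (adelicGram F e TV TW) (isUnit_det_adelicGram F e hVd hWd) Ψ : piSchwartzBruhat F (Fin (n + n))) : (Fin (n + n) → AdeleRing (𝓞 F) F) → ℂ) ξ)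
    (Ψ : piSchwartzBruhat F (Fin (n + n))) :
    ∫ ξ, thetaDistLM F (Fin (n + n))
        (adelicMpCont.omega F (Fin (n + n)) (doubledGramFin F (adelicGram F e TV TW))
          (((doublingLift F (adelicGram F e TV TW) (isUnit_det_adelicGram F e hVd hWd)).comp
            (iotaV F E c hcδ hδ hd N e TV hV TW hW)) (Quotient.out ξ)⁻¹) Ψ) ∂ν =
      ((ν Set.univ).toReal : ℂ) * Eis Ψ :=
  doubledThetaIntegral_eq_mul_of_proportional F E c hcδ hδ hd N e TV hV hVd TW hW hWd ν νX h hh hB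
    (thetaOrbitFunctionalReal_eq_smul_adelicSiegelFunctional F E c hcδ hδ hd N e TV hV hVd TW hW hWd ν νX h hh hhN hB htemp hfib)
    Eis hE Ψ

/-! ## §4 HEAD OF RECORD over the ★ δ-CARRIERS (`DoubledPair.*`), `hfib` supplied by ★ (T3) from the split-place frame -/

section Frame

variable (v : HeightOneSpectrum (𝓞 F))
  {K : Type*} [Field K] [ValuativeRel K] [TopologicalSpace K] [IsNonarchimedeanLocalField K]
  [MeasurableSpace K] [BorelSpace K] [MeasurableSingletonClass K] (μK : Measure K) [μK.IsAddHaarMeasure]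
  {κ : Type*} [Fintype κ] [Nonempty κ] [DecidableEq κ] (hκ : 2 ≤ Fintype.card κ)
  (βv : (Fin (n + n) → v.adicCompletion F) ≃ₜ ((κ → K) × (κ → K)))
  (fr : (Fin (n + n) → AdeleRing (𝓞 F) F) ≃ₜ (((κ → K) × (κ → K)) × AdelicVector.trivialAt F (Fin (n + n)) v))

include μK hκ in
/-- **I-CLOSE, OUTER ASSEMBLY — HEAD OF RECORD (identity half of `StubSW2iii` BY NAME over the ★ δ-CARRIERS `DoubledPair.*`,
closer-modulo-letters).**  `I□(Ψ) = κ₀ · E(Ψ)`, `κ₀ = (ν univ).toReal`, for the rank-one unitary dual pair, from the producers' letters in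
their shapes: `hhN` (E-side norm `h` is `hNorm`, pointwise; B-p04), `hB` + `htemp` (★ (E-DEC) binders; discharged for totally real `F` by
`hB_C0`∕`htemp_C0`, F0P4-p06), `hE` (★ (E-DEC) Fourier-side head `eis_eq_geomFrame_zero_add_tsum_siegelCoeff`, B-p02, read on
`DoubledPair.eis`), the SPLIT-PLACE FRAME at a finite place `v` — `fr : X□(𝔸) ≃ₜ (K^κ × K^κ) × Y`, `Y = trivialAt`, with `he1`∕`he2` (A-p01
`Theorems/H413E2SWSplitPlaceFrame` over B-p04's `β_v`) —, the fibre parameters `b' : F → K`, the two (T2a)-triples `H₁ H₂` for every `b`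
(A-p08 `FibreMeasureSplitPlace.map_fibreMeasure_identityClose_hypotheses` at `S := Λ_θ,ℝ` and `S := E_X`), and the per-slice DILATE BOUNDS
`hbd` ((BOUND-b) p07 ∘ COEFF-b F0P4-p08 ∘ (L-D-v)).  Proof = (T1) (A)+(B) with `hfib := ★ (T3) integral_fibreMeasure_eq_smul_of_splitPlaceFrame`.
[cite: Weil1965, Chap. VI n° 52, Théorème 5, pp. 76–77] -/
theorem doubledThetaIntegral_eq_mul_eis_of_frame
    (hhN : ∀ x, h x = hNorm F E c hcδ hδ N e TV hVd TW hWd x)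
    (hB : ∀ Φ ∈ piSchwartzBruhat F (Fin (n + n)), Summable fun ξ : F => ‖adelicSiegelCoeff F (Fin (n + n)) νX h Φ ξ‖)
    (htemp : ∀ Ψr : piSchwartzBruhatReal F (Fin (n + n)),
      Integrable (Ψr : (Fin (n + n) → AdeleRing (𝓞 F) F) → ℝ) (adelicSiegelMeasure F (Fin (n + n)) νX h hh hB) ∧
        ∫ x, (Ψr : (Fin (n + n) → AdeleRing (𝓞 F) F) → ℝ) x ∂(adelicSiegelMeasure F (Fin (n + n)) νX h hh hB) = adelicSiegelFunctional F (Fin (n + n)) νX h hh hB Ψr)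
    (hE : ∀ Ψ : piSchwartzBruhat F (Fin (n + n)),
      DoubledPair.eis (DoubledPair.actRat F N e TV hVd TW hWd) (DoubledPair.ratDoubledW F E c hcδ hδ hd N e TV hV hVd TW hW hWd)
        (DoubledPair.stabDiagRat F N e TV hVd TW hWd) (DoubledPair.ev0 F N e TV hVd TW hWd) Ψ =
      ((geomFrame F (adelicGram F e TV TW) (isUnit_det_adelicGram F e hVd hWd) Ψ : piSchwartzBruhat F (Fin (n + n))) : (Fin (n + n) → AdeleRing (𝓞 F) F) → ℂ) 0 + ∑' ξ : F, adelicSiegelCoeff F (Fin (n + n)) νX h ((geomFrame F (adelicGram F e TV TW) (isUnit_det_adelicGram F e hVd hWd) Ψ : piSchwartzBruhat F (Fin (n + n))) : (Fin (n + n) → AdeleRing (𝓞 F) F) → ℂ) ξ)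
    (he1 : ∀ x, (fr x).1 = βv (AdelicVector.evalAt F (Fin (n + n)) v x))
    (he2 : ∀ x, (fr x).2 = ((AdelicVector.placeSplitting F (Fin (n + n)) v).symm x).2)
    (b' : F → K)
    (H₁ : ∀ b : F, (∀ (L : Set ((κ → K) × (κ → K))) (B : Set (AdelicVector.trivialAt F (Fin (n + n)) v)), IsCompact L → IsCompact B →
        ((fibreMeasure F (Fin (n + n)) (thetaOrbitFunctionalReal F E c hcδ hδ hd N e TV hV hVd TW hW hWd ν) (thetaOrbitFunctionalReal_nonneg F E c hcδ hδ hd N e TV hV hVd TW hW hWd ν) h b).map fr) (L ×ˢ B) < ⊤) ∧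
      (∀ (g : GL κ K) (A : Set ((κ → K) × (κ → K))) (B : Set (AdelicVector.trivialAt F (Fin (n + n)) v)),
        MeasurableSet A → MeasurableSet B → ((fibreMeasure F (Fin (n + n)) (thetaOrbitFunctionalReal F E c hcδ hδ hd N e TV hV hVd TW hW hWd ν) (thetaOrbitFunctionalReal_nonneg F E c hcδ hδ hd N e TV hV hVd TW hW hWd ν) h b).map fr) (((fun z => (((g : Matrix κ κ K) *ᵥ z.1, ((g⁻¹ : GL κ K) : Matrix κ κ K)ᵀ *ᵥ z.2) : (κ → K) × (κ → K))) ⁻¹' A) ×ˢ B) = ((fibreMeasure F (Fin (n + n)) (thetaOrbitFunctionalReal F E c hcδ hδ hd N e TV hV hVd TW hW hWd ν) (thetaOrbitFunctionalReal_nonneg F E c hcδ hδ hd N e TV hV hVd TW hW hWd ν) h b).map fr) (A ×ˢ B)) ∧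
      ((fibreMeasure F (Fin (n + n)) (thetaOrbitFunctionalReal F E c hcδ hδ hd N e TV hV hVd TW hW hWd ν) (thetaOrbitFunctionalReal_nonneg F E c hcδ hδ hd N e TV hV hVd TW hW hWd ν) h b).map fr) ({z : (κ → K) × (κ → K) | z.1 ⬝ᵥ z.2 = b' b ∧ z.1 ≠ 0 ∧ z.2 ≠ 0}ᶜ ×ˢ (univ : Set (AdelicVector.trivialAt F (Fin (n + n)) v))) = 0)
    (H₂ : ∀ b : F, (∀ (L : Set ((κ → K) × (κ → K))) (B : Set (AdelicVector.trivialAt F (Fin (n + n)) v)), IsCompact L → IsCompact B →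
        ((adelicSiegelFibreMeasure F (Fin (n + n)) νX h hh hB b).map fr) (L ×ˢ B) < ⊤) ∧
      (∀ (g : GL κ K) (A : Set ((κ → K) × (κ → K))) (B : Set (AdelicVector.trivialAt F (Fin (n + n)) v)),
        MeasurableSet A → MeasurableSet B → ((adelicSiegelFibreMeasure F (Fin (n + n)) νX h hh hB b).map fr) (((fun z => (((g : Matrix κ κ K) *ᵥ z.1, ((g⁻¹ : GL κ K) : Matrix κ κ K)ᵀ *ᵥ z.2) : (κ → K) × (κ → K))) ⁻¹' A) ×ˢ B) = ((adelicSiegelFibreMeasure F (Fin (n + n)) νX h hh hB b).map fr) (A ×ˢ B)) ∧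
      ((adelicSiegelFibreMeasure F (Fin (n + n)) νX h hh hB b).map fr) ({z : (κ → K) × (κ → K) | z.1 ⬝ᵥ z.2 = b' b ∧ z.1 ≠ 0 ∧ z.2 ≠ 0}ᶜ ×ˢ (univ : Set (AdelicVector.trivialAt F (Fin (n + n)) v))) = 0)
    (hbd : ∀ (b : F) (Θ : piSchwartzBruhatReal F (Fin (n + n))), 0 ≤ (Θ : (Fin (n + n) → AdeleRing (𝓞 F) F) → ℝ) → HasCompactSupport (Θ : (Fin (n + n) → AdeleRing (𝓞 F) F) → ℝ) →
      ∀ t : Fin (n + n) → v.adicCompletion F, ∃ (s : ℕ → K) (M γ : ℝ), (∀ k, s k ≠ 0) ∧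
        Tendsto (fun k => (normAbs K (s k) : ℝ)) atTop atTop ∧ γ < (Fintype.card κ : ℝ) - 1 ∧
        ∀ k, |(∫⁻ z in {z : (κ → K) × (κ → K) | ((s k)⁻¹ • z.1, z.2) ∈ piPrimePowBall K κ 0 ×ˢ piPrimePowBall K κ 0} ×ˢ (univ : Set (AdelicVector.trivialAt F (Fin (n + n)) v)),
              ENNReal.ofReal ((Θ : (Fin (n + n) → AdeleRing (𝓞 F) F) → ℝ) (AdelicVector.placeSplitting F (Fin (n + n)) v (t, z.2))) ∂((fibreMeasure F (Fin (n + n)) (thetaOrbitFunctionalReal F E c hcδ hδ hd N e TV hV hVd TW hW hWd ν) (thetaOrbitFunctionalReal_nonneg F E c hcδ hδ hd N e TV hV hVd TW hW hWd ν) h b).map fr)).toReal -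
            ((ν Set.univ).toReal : ℝ) * (∫⁻ z in {z : (κ → K) × (κ → K) | ((s k)⁻¹ • z.1, z.2) ∈ piPrimePowBall K κ 0 ×ˢ piPrimePowBall K κ 0} ×ˢ (univ : Set (AdelicVector.trivialAt F (Fin (n + n)) v)),
              ENNReal.ofReal ((Θ : (Fin (n + n) → AdeleRing (𝓞 F) F) → ℝ) (AdelicVector.placeSplitting F (Fin (n + n)) v (t, z.2))) ∂((adelicSiegelFibreMeasure F (Fin (n + n)) νX h hh hB b).map fr)).toReal|
          ≤ M * (normAbs K (s k) : ℝ) ^ γ)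
    (Ψ : piSchwartzBruhat F (Fin (n + n))) :
    DoubledPair.doubledThetaIntegral F E c hcδ hδ hd N e TV hV hVd TW hW hWd ν Ψ =
      ((ν Set.univ).toReal : ℂ) * DoubledPair.eis (DoubledPair.actRat F N e TV hVd TW hWd) (DoubledPair.ratDoubledW F E c hcδ hδ hd N e TV hV hVd TW hW hWd)
        (DoubledPair.stabDiagRat F N e TV hVd TW hWd) (DoubledPair.ev0 F N e TV hVd TW hWd) Ψ := by
  have hfib : ∀ (b : F) (Θ : piSchwartzBruhatReal F (Fin (n + n))), 0 ≤ (Θ : (Fin (n + n) → AdeleRing (𝓞 F) F) → ℝ) →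
      HasCompactSupport (Θ : (Fin (n + n) → AdeleRing (𝓞 F) F) → ℝ) →
      ∫ x, (Θ : (Fin (n + n) → AdeleRing (𝓞 F) F) → ℝ) x ∂(fibreMeasure F (Fin (n + n)) (thetaOrbitFunctionalReal F E c hcδ hδ hd N e TV hV hVd TW hW hWd ν) (thetaOrbitFunctionalReal_nonneg F E c hcδ hδ hd N e TV hV hVd TW hW hWd ν) h b) =
        (ν Set.univ).toReal * ∫ x, (Θ : (Fin (n + n) → AdeleRing (𝓞 F) F) → ℝ) x ∂(adelicSiegelFibreMeasure F (Fin (n + n)) νX h hh hB b) := by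
    intro b Θ h0 hc
    have hT3 := E2SWIdentityCloseFibre.integral_fibreMeasure_eq_smul_of_splitPlaceFrame F (Fin (n + n)) (thetaOrbitFunctionalReal F E c hcδ hδ hd N e TV hV hVd TW hW hWd ν) (adelicSiegelFunctional F (Fin (n + n)) νX h hh hB)
      (thetaOrbitFunctionalReal_nonneg F E c hcδ hδ hd N e TV hV hVd TW hW hWd ν) (fun Ψ hΨ => (adelicSiegelFunctional_nonneg hh hB Ψ hΨ).1) h b v μK hκ (b' b) (ν Set.univ).toNNReal βv fr he1 he2
      (H₁ b) (by simpa only [adelicSiegelFibreMeasure] using H₂ b) Θ h0 hc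
      (by simpa only [ENNReal.coe_toNNReal_eq_toReal, adelicSiegelFibreMeasure] using hbd b Θ h0 hc)
    simpa only [ENNReal.coe_toNNReal_eq_toReal, adelicSiegelFibreMeasure] using hT3
  exact doubledThetaIntegral_eq_mul_of_fibre F E c hcδ hδ hd N e TV hV hVd TW hW hWd ν νX h hh hhN hB htemp hfib _ hE Ψ

end Frame

end DualPair

end Summit.HodgeConjecture.HodgeConjecture.Cruxes.H413.E2SWIdentityClose

end
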